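import Mathlib
import HarnessLib
import Summits.AtomisticToContinuum.FouriersLaw.Theses.JunctionLocality

/-!
# Sketch — crux-ideate (k = 1, round 1) for `JunctionLocality.SuperadditiveResistance` (stmt-AtomisticToContinuum-11748)

First checkable statements of the two idea cards

* `Ideas/thermalise-then-cut-probe-insertion.md` (Card A): `ContactFloor` (exact consequence of
  Green–Kubo positivity, over existing declarations only) and `ProbeInsertionBounded` (step α of
  the line: a γ-probe pair clamped at the mean temperature on the two junction sites of the
  `2N`-chain changes the end-to-end linear-response resistance by `O(1)`), typed over a local
  multi-bath generator `mbGenerator` (Langevin thermostats of strength `η i`, temperature `θ i`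
  at every site; the tree's `OscillatorChain.generator` is the profile "γ at the two ends").
* `Ideas/double-escape-termination-locality.md` (Card B): the real-analysis reduction
  `threeTerminalSeries` (floating-node series law with `O(g²)` defects ⇒ additive resistances up
  to `O(1)`) and `TerminationLocality` (step β: attaching anything beyond a γ-bathed site moves
  the self-conductance of the far bath by `O(g²)`).

Nothing here is a route item; these are first lemmas of LINES on the fixed crux. No `sorry` in
statements; proofs are not attempted (`Prop` definitions only, plus one trivial sanity `example`).
-/

noncomputable section

open MeasureTheory Filter Topology
open scoped ContDiff
open Literature.MathematicalPhysics.KineticTheory.HeatConduction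

namespace Summit.AtomisticToContinuum.FouriersLaw.Cruxes.SuperadditiveResistance.Sketch

/-! ## Card A, lemma 0 — the contact floor `R_N ≥ 2/γ` (over existing declarations only)

`J̃ = γ(T_L − ⟨p_0²⟩) = γ(⟨p_{N−1}²⟩ − T_R)` (energy balance at the two bathed sites) gives
`2J̃ = γ(δ − (⟨p_0²⟩ − ⟨p_{N−1}²⟩))`, and the first-order response of `⟨p_0²⟩ − ⟨p_{N−1}²⟩` to the
antisymmetric bias is the DIAGONAL Green–Kubo form `(γ/2T²)⟨A, (−L_T)⁻¹A⟩_{Gibbs} ≥ 0`,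
`A = p_0² − p_{N−1}²` (the resolvent of the equilibrium generator is accretive). Hence
`G_N = D_N/(N−1) ≤ γ/2`, i.e. every Langevin contact carries resistance `≥ 1/γ`; sharp as `γ → 0`
for the harmonic chain (`J → γ(T_L−T_R)/2`, Lepri–Livi–Politi 2003 §4.1). In the crux's own
quantifier frame: -/
def ContactFloor : Prop :=
  ∀ ω₂ lam β γ : ℝ, 0 < ω₂ → 0 < lam → 0 < β → 0 < γ →
    (∀ (N : ℕ) (T_L T_R : ℝ), 0 < T_L → 0 < T_R →
      ∀ μ ν : Measure (PhaseSpace N),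
        (pinnedChain ω₂ lam β γ).IsSteadyState N T_L T_R μ →
        (pinnedChain ω₂ lam β γ).IsSteadyState N T_L T_R ν → μ = ν) →
    ∀ μ : (N : ℕ) → ℝ → ℝ → Measure (PhaseSpace N),
      (∀ (N : ℕ) (T_L T_R : ℝ), 0 < T_L → 0 < T_R →
        (pinnedChain ω₂ lam β γ).IsSteadyState N T_L T_R (μ N T_L T_R)) →
      ∀ T : ℝ, 0 < T → ∀ D : ℕ → ℝ,
        (∀ N : ℕ, Tendsto (fun δ : ℝ =>
            (pinnedChain ω₂ lam β γ).totalCurrent (μ N (T + δ / 2) (T - δ / 2)) / δ)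
          (𝓝[≠] 0) (𝓝 (D N))) →
        ∀ N : ℕ, 2 ≤ N → D N ≤ γ / 2 * ((N : ℝ) - 1)

/-! ## Multi-bath Langevin generator (local definition for the probed configurations) -/

variable (P : OscillatorChain)

/-- `L f = Σ_i (p_i ∂_{q_i} f − ∂_{q_i}H ∂_{p_i} f) + Σ_i η_i (θ_i ∂²_{p_i} f − p_i ∂_{p_i} f)`:
the Hamiltonian vector field of `P.hamiltonian N` plus an Ornstein–Uhlenbeck thermostat of
strength `η i ≥ 0` and temperature `θ i` at every site `i` (`η i = 0` = no bath there). With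
`η = γ·1_{i ∈ {0, N−1}}`, `θ 0 = T_L`, `θ (N−1) = T_R` this is `P.generator N T_L T_R`
(for `N ≥ 2`). Probes CLAMPED at the mean temperature preserve the Gibbs state at `δ = 0`, which is
what makes the resolvent identity of Card A exact. -/
def mbGenerator (N : ℕ) (η θ : Fin N → ℝ) (f : PhaseSpace N → ℝ) (x : PhaseSpace N) : ℝ :=
  (∑ i, (x.2 i * partialQ i f x - partialQ i (P.hamiltonian N) x * partialP i f x)) +
    ∑ i : Fin N, η i * (θ i * partialP i (partialP i f) x - x.2 i * partialP i f x)

/-- Weak steady state of the multi-bath chain (same class as `OscillatorChain.IsSteadyState`: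
probability, `∫ L f dμ = 0` on `C_c^∞`, bond currents integrable). -/
def IsMBSteadyState (N : ℕ) (η θ : Fin N → ℝ) (μ : Measure (PhaseSpace N)) : Prop :=
  IsProbabilityMeasure μ ∧
    (∀ f : PhaseSpace N → ℝ, ContDiff ℝ ∞ f → HasCompactSupport f →
      ∫ x, mbGenerator P N η θ f x ∂μ = 0) ∧
    ∀ i : Fin N, Integrable (P.bondCurrent N i) μ

/-- Bath-strength profile of configuration (ii): strength `γ` on the two ends AND on the two
junction sites `N−1`, `N` of the `2N`-chain. -/
def probePairStrength (γ : ℝ) (N : ℕ) : Fin (2 * N) → ℝ :=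
  fun i => if i.val = 0 ∨ i.val = N - 1 ∨ i.val = N ∨ i.val = 2 * N - 1 then γ else 0

/-- Temperature profile of configuration (ii): `T_L` at site `0`, `T_R` at site `2N−1`, the probes
clamped at the mean `(T_L + T_R)/2` (by the reflection symmetry of the `2N`-chain this is also the
self-consistent = zero-net-uptake temperature of the shorted pair at first order in `T_L − T_R`). -/
def probePairTemp (T_L T_R : ℝ) (N : ℕ) : Fin (2 * N) → ℝ :=
  fun i => if i.val = 0 then T_L else if i.val = 2 * N - 1 then T_R else (T_L + T_R) / 2

/-- Mean energy current through the FIRST bond `(0,1)` — "the" current of configuration (ii)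
(all bonds except the junction bond carry it; it equals the left bath power). -/
def leftCurrent {N : ℕ} (μ : Measure (PhaseSpace N)) : ℝ :=
  ∑ i : Fin N, if i.val = 0 then ∫ x, P.bondCurrent N i x ∂μ else 0

/-! ## Card A, first lemma of the line — step α: probe insertion costs `O(1)` in resistance

For the pinned chain and every `T > 0`: along (unique) steady-state families of the plain
`2N`-chain (`μ`) and of the probed `2N`-chain (`ν`, configuration (ii)), with bond-`0` response
coefficients `g N` and `gp N` (conductances; `g N = D_{2N}/(2N−1)` in the crux's notation),
`|1/gp N − 1/g N| ≤ C` for all `N ≥ 2`. Engine (card): the exact identity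
`gp − g = −γ² ⟨S_K ḡ, (I − Π_K) h⟩_{Gibbs}` (resolvent identity for two Gibbs-preserving generators;
`S_K` = the OU operator of the probe pair, `Π_K` = conditional expectation over the two junction
momenta, `h` = first-order NESS density of the plain chain, `ḡ` = forward Poisson solution of the
probed chain), bounded by SIZE not sign: `|gp − g| ≤ γ² ‖S_K ḡ‖ · v_K(h)^{1/2}` with the junction
roughness `v_K(h) ≥ 2 g²/(T·E[V'(r)²])` (Cauchy–Schwarz in `g = ⟨j_b, (I−Π_K)h⟩`, exact) and the
bets `v_K(h) ≤ C_ϱ g²`, `‖S_K ḡ‖ ≤ C_ς gp`. -/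
def ProbeInsertionBounded : Prop :=
  ∀ ω₂ lam β γ : ℝ, 0 < ω₂ → 0 < lam → 0 < β → 0 < γ → ∀ T : ℝ, 0 < T →
    -- uniqueness of weak steady states, plain and probed
    (∀ (N : ℕ) (T_L T_R : ℝ), 0 < T_L → 0 < T_R →
      ∀ μ μ' : Measure (PhaseSpace N),
        (pinnedChain ω₂ lam β γ).IsSteadyState N T_L T_R μ →
        (pinnedChain ω₂ lam β γ).IsSteadyState N T_L T_R μ' → μ = μ') →
    (∀ (N : ℕ) (T_L T_R : ℝ), 0 < T_L → 0 < T_R →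
      ∀ ν ν' : Measure (PhaseSpace (2 * N)),
        IsMBSteadyState (pinnedChain ω₂ lam β γ) (2 * N) (probePairStrength γ N)
          (probePairTemp T_L T_R N) ν →
        IsMBSteadyState (pinnedChain ω₂ lam β γ) (2 * N) (probePairStrength γ N)
          (probePairTemp T_L T_R N) ν' → ν = ν') →
    ∀ (μ : (N : ℕ) → ℝ → ℝ → Measure (PhaseSpace (2 * N)))
      (ν : (N : ℕ) → ℝ → ℝ → Measure (PhaseSpace (2 * N))),
      (∀ (N : ℕ) (T_L T_R : ℝ), 0 < T_L → 0 < T_R →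
        (pinnedChain ω₂ lam β γ).IsSteadyState (2 * N) T_L T_R (μ N T_L T_R)) →
      (∀ (N : ℕ) (T_L T_R : ℝ), 0 < T_L → 0 < T_R →
        IsMBSteadyState (pinnedChain ω₂ lam β γ) (2 * N) (probePairStrength γ N)
          (probePairTemp T_L T_R N) (ν N T_L T_R)) →
      ∀ g gp : ℕ → ℝ,
        (∀ N : ℕ, Tendsto (fun δ : ℝ =>
            leftCurrent (pinnedChain ω₂ lam β γ) (μ N (T + δ / 2) (T - δ / 2)) / δ)
          (𝓝[≠] 0) (𝓝 (g N))) →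
        (∀ N : ℕ, Tendsto (fun δ : ℝ =>
            leftCurrent (pinnedChain ω₂ lam β γ) (ν N (T + δ / 2) (T - δ / 2)) / δ)
          (𝓝[≠] 0) (𝓝 (gp N))) →
        (∀ N : ℕ, 2 ≤ N → 0 < g N ∧ 0 < gp N) →
        ∃ C : ℝ, ∀ N : ℕ, 2 ≤ N → |1 / gp N - 1 / g N| ≤ C

/-! ## Card B, lemma 0 — three-terminal series law with `O(g²)` defects (pure real analysis)

In the probed configuration (ii) write the 3-terminal transfer conductances (left bath `1`,
shorted probe node `m`, right bath `4`): the floating-node conductance is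
`G = x + (a − x)(b − x)/(a + b − 2x)` with `a = L₁₁` (self-conductance of bath 1), `b = L₄₄`,
`x = g₁₄` (direct transmission past the probed sites). If `a = g_N(1 + O(g_N))`,
`b = g_M(1 + O(g_M))` (termination locality) and `0 ≤ x ≤ c·g_N g_M` (far transmission = double
escape), then `1/G ≥ 1/g_N + 1/g_M − C`: the resistance of (ii) is at least the cut value minus a
constant (step β, the direction the crux needs). -/
def threeTerminalSeries : Prop :=
  ∀ c : ℝ, 0 < c → ∃ C ε : ℝ, 0 < ε ∧ ∀ gN gM a b x : ℝ,
    0 < gN → gN < ε → 0 < gM → gM < ε →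
    |a - gN| ≤ c * gN ^ 2 → |b - gM| ≤ c * gM ^ 2 → 0 ≤ x → x ≤ c * gN * gM →
      1 / gN + 1 / gM - C ≤ 1 / (x + (a - x) * (b - x) / (a + b - 2 * x))

/-- Bath-strength profile "γ at the two ends of the first `N` sites and at the far end": sites
`0`, `N−1`, `N+M−1` of an `(N+M)`-chain (the `N`-chain with a γ-probe kept at its old far end
`N−1`, plus an attachment of `M` sites terminated by a γ-bath). -/
def attachStrength (γ : ℝ) (N M : ℕ) : Fin (N + M) → ℝ :=
  fun i => if i.val = 0 ∨ i.val = N - 1 ∨ i.val = N + M - 1 then γ else 0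

/-- Temperatures for the self-conductance measurement: heat ONLY bath `0` to `T + ε`, every other
thermostat at `T`. -/
def attachTemp (T ε : ℝ) (N M : ℕ) : Fin (N + M) → ℝ :=
  fun i => if i.val = 0 then T + ε else T

/-! ## Card B, first lemma of the line — step β(a): TERMINATION LOCALITY at a γ-bathed site

`L₁₁(N) := ∂J_0/∂T_0` (self-conductance of the left bath; for the plain `N`-chain it equals the
two-terminal conductance `g_N`). Attaching an arbitrary further piece of pinned chain (length `M`,
its own γ-bath at `T`) beyond the γ-bathed site `N−1` changes `L₁₁` by at most `C·g_N²`,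
uniformly in `N, M`. Lever (card): energy arriving at a γ-bathed site is renewed there; to feel the
attachment and report back to bath `0` a fluctuation must escape the contact twice
(divider ratio `θ_N ≤ c/ (γ R_N)` each way). -/
def TerminationLocality : Prop :=
  ∀ ω₂ lam β γ : ℝ, 0 < ω₂ → 0 < lam → 0 < β → 0 < γ → ∀ T : ℝ, 0 < T →
    ∀ (μ : (N : ℕ) → ℝ → Measure (PhaseSpace N))
      (ν : (N M : ℕ) → ℝ → Measure (PhaseSpace (N + M))),
      -- μ N ε : steady state of the N-chain with baths (T + ε, T); ν N M ε : of the attached system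
      (∀ (N : ℕ) (ε : ℝ), -T < ε →
        (pinnedChain ω₂ lam β γ).IsSteadyState N (T + ε) T (μ N ε)) →
      (∀ (N M : ℕ) (ε : ℝ), -T < ε →
        IsMBSteadyState (pinnedChain ω₂ lam β γ) (N + M) (attachStrength γ N M)
          (attachTemp T ε N M) (ν N M ε)) →
      -- uniqueness in both classes (else the ∀-family form is false-prone)
      (∀ (N : ℕ) (ε : ℝ), -T < ε → ∀ ρ : Measure (PhaseSpace N),
        (pinnedChain ω₂ lam β γ).IsSteadyState N (T + ε) T ρ → ρ = μ N ε) →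
      (∀ (N M : ℕ) (ε : ℝ), -T < ε → ∀ ρ : Measure (PhaseSpace (N + M)),
        IsMBSteadyState (pinnedChain ω₂ lam β γ) (N + M) (attachStrength γ N M)
          (attachTemp T ε N M) ρ → ρ = ν N M ε) →
      ∀ (g : ℕ → ℝ) (L : ℕ → ℕ → ℝ),
        (∀ N : ℕ, Tendsto (fun ε : ℝ =>
            leftCurrent (pinnedChain ω₂ lam β γ) (μ N ε) / ε) (𝓝[≠] 0) (𝓝 (g N))) →
        (∀ N M : ℕ, Tendsto (fun ε : ℝ =>
            leftCurrent (pinnedChain ω₂ lam β γ) (ν N M ε) / ε) (𝓝[≠] 0) (𝓝 (L N M))) →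
        ∃ C : ℝ, ∀ N M : ℕ, 2 ≤ N → 1 ≤ M → |L N M - g N| ≤ C * g N ^ 2

/-- Sanity: the probe-pair strength profile puts a bath on site `0`. -/
example (γ : ℝ) (N : ℕ) (h : 0 < 2 * N) : probePairStrength γ N ⟨0, h⟩ = γ := by
  simp [probePairStrength]

end Summit.AtomisticToContinuum.FouriersLaw.Cruxes.SuperadditiveResistance.Sketch
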